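import Literature.NumberTheory.EllipticCurves.ComplexMultiplicationBurungaleFlachKatoProofs
import Literature.NumberTheory.EllipticCurves.ComplexMultiplicationBurungaleFlachCorOneThreeLeavesProofs
import HarnessLib

/-!
# Burungale–Flach 2024, Theorem 1.1 at `F = K`: census below Kato's finiteness theorem

Proof sibling (D-0014 append protocol: a new file, theorems only — no definition, no named fact
introduced or restated, no instance) of `ComplexMultiplicationBurungaleFlachCorOneProofs.lean`
for its named fact

> `Literature.NumberTheory.EllipticCurves.BurungaleFlach2024_main_cmField` — A. Burungale,
> M. Flach, *The conjecture of Birch and Swinnerton-Dyer for certain elliptic curves with complex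
> multiplication*, Camb. J. Math. 12 (2024), no. 2, arXiv:2206.09874, **Theorem 1.1 with
> Remark 1 at `F = K`**: for `E/ℚ` with `j(E) ∈ maximalCMJInvariants` and `L(E/ℚ, 1) ≠ 0`, `K`
> its CM field and `W'` a globally minimal model of `E_K` with CM period lattice `Ω · 𝓞_K`:
> `E(K)` and `Ш(E_K/K)` are finite and `L(E/ℚ,1)/Ω = z` with
> `z² · #E(K)² = u · #Ш(E_K/K) · ∏_v c_v` for some `z ∈ K`, `u ∈ 𝓞_K^×`.

## What is proved

The assembly of record (`BurungaleFlach2024_main_cmField_of_three_leaves`,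
`…CorOneThreeLeavesProofs.lean`) puts the fact on three named facts: the paper's own
contribution `BurungaleFlach2024_main_cmField_pPart` (Prop. 2.3 with Lemma 13 at `F = K` for
every prime `p`: the `{𝔭 ∣ p}`-part of the `𝓞_K`-equivariant formula, from the two-variable
main conjecture Thm. 4.1 and the reciprocity law Prop. 3.1), and, for the finiteness half
(Prop. 4.1, Remark 10), Rubin 1987 §10 (`Rubin1987_sha_primary_finite`) and Coates–Wiles 1977 §6
(`CoatesWiles1977_L_one_div_period_mem_prime`). Since then the finiteness half has been put,
sorry-free, below the single rank-zero leaf of the BSD cone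
(`BurungaleFlach2024_finite_primary_cmField_of_Kato`, `…KatoProofs.lean`: Kato, Astérisque 295
(2004), Cor. 14.3 for the quadratic field `K`, recovered from its instance `K = ℚ`, `χ = 1`
(`kato_finite_of_L_one_ne_zero`, bsd.S20) by the quadratic descent of `p^∞`-Selmer groups and
the CM twist isogeny `E ∼ E^{(d_K)}`). This file records the consequence for Theorem 1.1 at
`F = K` and for the two statements assembled through it; nothing is added, two leaves are
exchanged for one that the whole cone already carries:

* `BurungaleFlach2024_main_cmField_of_pPart_of_Kato` (**proved**): Theorem 1.1 with Remark 1 at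
  `F = K` from `BurungaleFlach2024_main_cmField_pPart` (`hB`) and Kato's Cor. 14.3 over `ℚ` for
  every elliptic `E/ℚ` and every prime (`hK`);
* `BurungaleFlach2024_main_cmField_iff_pPart_of_Kato` (**proved**): modulo Kato's theorem alone,
  Theorem 1.1 at `F = K` **is** its formula half `BurungaleFlach2024_main_cmField_pPart`;
* `BurungaleFlach2024_main_cmField_of_pPart_of_GrossZagierKolyvagin`,
  `…_iff_pPart_of_GrossZagierKolyvagin` (**proved**): the same with bsd.S17
  (`rank_eq_analyticRank_of_analyticRank_le_one`, Gross–Zagier–Kolyvagin, Darmon 2004 Thm. 3.22)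
  in place of bsd.S20, through `kato_finite_of_L_one_ne_zero_of_rank_eq_analyticRank`;
* `BurungaleFlach2024_bsd_cmField_of_pPart_of_Kato` (**proved**): Corollary 1 at `F = K`
  (`BurungaleFlach2024_bsd_cmField`) from the same two leaves;
* `bsdTriple_of_j_mem_maximalCMJInvariants_of_L_one_ne_zero_of_pPart_of_Kato` (**proved**):
  bsd.S28 (rank-zero BSD for `E/ℚ` with CM by `𝓞_K` and `L(E,1) ≠ 0`) from five named facts —
  `hB`, `hK` and the three descent leaves of Corollary 2 (Milne 1972 Thm. 1 `hBC`, Cassels'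
  isogeny invariance `hISO`, `L(E,1) ≥ 0` `hPOS`) — in place of the six of
  `bsdTriple_of_j_mem_maximalCMJInvariants_of_L_one_ne_zero_of_six_leaves`.

So the debt proper to Burungale–Flach's Theorem 1.1 at `F = K` is exactly
`BurungaleFlach2024_main_cmField_pPart`; the discharge `BurungaleFlach2024_main_cmField_holds`
is `BurungaleFlach2024_main_cmField_of_pPart_of_Kato BurungaleFlach2024_main_cmField_pPart_holds
(fun W _ p _ ↦ kato_finite_of_L_one_ne_zero_holds W p)` the day both exist. It is **not**
asserted here.

## References

* A. Burungale, M. Flach, Camb. J. Math. 12 (2024), no. 2, arXiv:2206.09874: Thm. 1.1, Remark 1,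
  Cor. 1, Cor. 2 (pp. 3–4), Prop. 2.3 (p. 12), Prop. 4.1 and Remark 10 (p. 19), §4.5 proof of
  Thm. 1.1 with Lemma 13 (pp. 21–23). [BurungaleFlach2024]
* K. Kato, *`p`-adic Hodge theory and values of zeta functions of modular forms*, Astérisque 295
  (2004): Thm. 14.2, Cor. 14.3 (p. 235). [Kato2004Asterisque]
* H. Darmon, *Rational points on modular elliptic curves*, CBMS 101 (2004), Thm. 3.22. [Darmon2004]
-/

noncomputable section

open WeierstrassCurve

namespace Literature.NumberTheory.EllipticCurves

/-! ### Theorem 1.1 over `K` from its formula half and Kato's finiteness theorem -/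

/-- **Burungale–Flach, Theorem 1.1 with Remark 1 at `F = K`, from two leaves**: Prop. 2.3 with
Lemma 13 at `F = K` for every `p` (`hB`) and Kato's finiteness theorem over `ℚ` for every
elliptic curve and every prime (`hK`, bsd.S20; Kato, Astérisque 295, Cor. 14.3). The finiteness
half (Prop. 4.1 at `F = K`) is `BurungaleFlach2024_finite_primary_cmField_of_Kato hK`; the two
halves are put together by the last paragraph of the printed proof (local–global passage,
`BurungaleFlach2024_main_cmField_of_halves`).
[cite: BurungaleFlach2024, Thm. 1.1 and Remark 1 (p. 3), proof of Thm. 1.1 (p. 22) with Prop. 2.3, Lemma 13, Prop. 4.1]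
[cite: Kato2004Asterisque, Cor. 14.3 (p. 235)] -/
theorem BurungaleFlach2024_main_cmField_of_pPart_of_Kato
    (hB : BurungaleFlach2024_main_cmField_pPart)
    (hK : ∀ (W : WeierstrassCurve ℚ) [W.IsElliptic] (p : ℕ) [Fact p.Prime],
      kato_finite_of_L_one_ne_zero W p) :
    BurungaleFlach2024_main_cmField :=
  BurungaleFlach2024_main_cmField_of_halves (BurungaleFlach2024_finite_primary_cmField_of_Kato hK)
    hB

/-- **Modulo Kato's finiteness theorem, Theorem 1.1 at `F = K` is equivalent to its formula
half** `BurungaleFlach2024_main_cmField_pPart` (Prop. 2.3 with Lemma 13 at `F = K` for every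
`p`): the forward direction is unconditional (`BurungaleFlach2024_main_cmField_pPart_of_main`),
the backward one is the previous theorem. Sharpens
`BurungaleFlach2024_main_cmField_iff_pPart_of_two_leaves` (Rubin 1987 §10, Coates–Wiles 1977 §6)
to the single rank-zero leaf of the cone.
[cite: BurungaleFlach2024, proof of Thm. 1.1 (p. 22) with Prop. 2.3 and Lemma 13]
[cite: Kato2004Asterisque, Cor. 14.3 (p. 235)] -/
theorem BurungaleFlach2024_main_cmField_iff_pPart_of_Kato
    (hK : ∀ (W : WeierstrassCurve ℚ) [W.IsElliptic] (p : ℕ) [Fact p.Prime],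
      kato_finite_of_L_one_ne_zero W p) :
    BurungaleFlach2024_main_cmField ↔ BurungaleFlach2024_main_cmField_pPart :=
  ⟨BurungaleFlach2024_main_cmField_pPart_of_main,
    fun hB => BurungaleFlach2024_main_cmField_of_pPart_of_Kato hB hK⟩

/-- **Theorem 1.1 with Remark 1 at `F = K` from its formula half and Gross–Zagier–Kolyvagin**
(bsd.S17, `rank_eq_analyticRank_of_analyticRank_le_one`; Darmon 2004, Thm. 3.22), which implies
Kato's finiteness statement for every elliptic `E/ℚ` and every prime
(`kato_finite_of_L_one_ne_zero_of_rank_eq_analyticRank`).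
[cite: BurungaleFlach2024, Thm. 1.1 and Remark 1 (p. 3), proof of Thm. 1.1 (p. 22)]
[cite: Darmon2004, Thm. 3.22] -/
theorem BurungaleFlach2024_main_cmField_of_pPart_of_GrossZagierKolyvagin
    (hB : BurungaleFlach2024_main_cmField_pPart)
    (h17 : rank_eq_analyticRank_of_analyticRank_le_one) : BurungaleFlach2024_main_cmField :=
  BurungaleFlach2024_main_cmField_of_pPart_of_Kato hB fun W _ p _ ↦
    kato_finite_of_L_one_ne_zero_of_rank_eq_analyticRank W p h17

/-- **Modulo Gross–Zagier–Kolyvagin (bsd.S17), Theorem 1.1 at `F = K` is equivalent to its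
formula half** `BurungaleFlach2024_main_cmField_pPart`.
[cite: BurungaleFlach2024, proof of Thm. 1.1 (p. 22) with Prop. 2.3 and Lemma 13]
[cite: Darmon2004, Thm. 3.22] -/
theorem BurungaleFlach2024_main_cmField_iff_pPart_of_GrossZagierKolyvagin
    (h17 : rank_eq_analyticRank_of_analyticRank_le_one) :
    BurungaleFlach2024_main_cmField ↔ BurungaleFlach2024_main_cmField_pPart :=
  BurungaleFlach2024_main_cmField_iff_pPart_of_Kato fun W _ p _ ↦
    kato_finite_of_L_one_ne_zero_of_rank_eq_analyticRank W p h17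

/-! ### Corollary 1 over `K` and bsd.S28 -/

/-- **Corollary 1 at `F = K` from two leaves**: Prop. 2.3 with Lemma 13 at `F = K` (`hB`) and
Kato's finiteness theorem (`hK`), through `BurungaleFlach2024_bsd_cmField_of_printed_halves`
(the printed proofs of Thm. 1.1, last paragraph, and of Cor. 1, Deuring's identity included, are
theorems of the tree). Replaces the census `BurungaleFlach2024_bsd_cmField_of_three_leaves`.
[cite: BurungaleFlach2024, Cor. 1 and its proof (p. 3), proof of Thm. 1.1 (p. 22)]
[cite: Kato2004Asterisque, Cor. 14.3 (p. 235)] -/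
theorem BurungaleFlach2024_bsd_cmField_of_pPart_of_Kato
    (hB : BurungaleFlach2024_main_cmField_pPart)
    (hK : ∀ (W : WeierstrassCurve ℚ) [W.IsElliptic] (p : ℕ) [Fact p.Prime],
      kato_finite_of_L_one_ne_zero W p) :
    BurungaleFlach2024_bsd_cmField :=
  BurungaleFlach2024_bsd_cmField_of_printed_halves
    (BurungaleFlach2024_finite_primary_cmField_of_Kato hK) hB

/-- **bsd.S28 from five leaves.** The rank-zero Birch–Swinnerton-Dyer statement for `E/ℚ` with
CM by `𝓞_K` and `L(E,1) ≠ 0` (`bsdTriple_of_j_mem_maximalCMJInvariants_of_L_one_ne_zero`;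
Burungale–Flach 2024, Thm. 1.1, Cor. 1, Cor. 2) follows, sorry-free, from

1. `BurungaleFlach2024_main_cmField_pPart` (`hB`) — Prop. 2.3 with Lemma 13 at `F = K`, all `p`;
2. `kato_finite_of_L_one_ne_zero` for every elliptic `E/ℚ` and prime (`hK`) — Kato, Cor. 14.3;
3. `bsdRHS_baseChange_quadratic` (`hBC`) — Milne 1972, Thm. 1, rank-zero quotient form;
4. `bsdRHS_eq_of_isIsogenous` (`hISO`) — Cassels 1965 / Milne *ADT* I.7.3;
5. `re_entireLFunction_one_nonneg` (`hPOS`) — `L(E, 1) ≥ 0`: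

Corollary 1 over `K` from the first two (`BurungaleFlach2024_bsd_cmField_of_pPart_of_Kato`) fed
into the three-leaf descent `BurungaleFlach2024_bsd_rat_of_corOne_of_three_leaves` and
`bsdTriple_of_j_mem_maximalCMJInvariants_of_L_one_ne_zero_of_BurungaleFlach2024`. Replaces
`bsdTriple_of_j_mem_maximalCMJInvariants_of_L_one_ne_zero_of_six_leaves` (Rubin 1987 §10 and
Coates–Wiles 1977 §6 exchanged for the rank-zero leaf bsd.S20 shared by the cone).
[cite: BurungaleFlach2024, Thm. 1.1 and its proof, Cor. 1, Cor. 2 (arXiv pp. 3–4, 22)]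
[cite: Kato2004Asterisque, Cor. 14.3 (p. 235)] -/
theorem bsdTriple_of_j_mem_maximalCMJInvariants_of_L_one_ne_zero_of_pPart_of_Kato
    (hB : BurungaleFlach2024_main_cmField_pPart)
    (hK : ∀ (W : WeierstrassCurve ℚ) [W.IsElliptic] (p : ℕ) [Fact p.Prime],
      kato_finite_of_L_one_ne_zero W p)
    (hBC : bsdRHS_baseChange_quadratic) (hISO : bsdRHS_eq_of_isIsogenous)
    (hPOS : re_entireLFunction_one_nonneg) :
    bsdTriple_of_j_mem_maximalCMJInvariants_of_L_one_ne_zero :=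
  bsdTriple_of_j_mem_maximalCMJInvariants_of_L_one_ne_zero_of_BurungaleFlach2024
    (BurungaleFlach2024_bsd_rat_of_corOne_of_three_leaves
      (BurungaleFlach2024_bsd_cmField_of_pPart_of_Kato hB hK) hBC hISO hPOS)

end Literature.NumberTheory.EllipticCurves

end
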